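import Literature.NumberTheory.Automorphic.CompactCoreCentralizerNonarch
import Literature.NumberTheory.Automorphic.OrbitalMeasureCanonicalExists
import Literature.NumberTheory.Automorphic.UnitaryGroupSplitPlace
import Literature.NumberTheory.Automorphic.LocalUnitaryGroupCongr
import Literature.NumberTheory.Automorphic.LocalUnitaryIntegralLevel
import Literature.NumberTheory.Automorphic.LocalUnitaryGroupCongrMeasure
import Literature.NumberTheory.Automorphic.UnitaryGroupOfFormAdelicTopology
import HarnessLib

/-!
# The compact core of the centraliser of a regular semisimple element of `U(J)(F_v)` (split and non-split places) and of `H_v = U × U`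
(Tits (1979), §3.9; Platonov–Rapinchuk (1994), §3.3, §5.1; Rogawski (1990), §4.3 p. 43 «compatible measures on `H_{γ_H}` and `G_γ`»)

Topic `NumberTheory/Automorphic`; namespace `Literature.NumberTheory.Automorphic` (§1–§2) and `….UnitaryGroup` (§3).  THEOREMS ONLY (no definition, no
instance, no notation, no named fact, no `sorry`).  Cell `pub/hodgecm-mathlib`, P3a road D-N6s, brick **«g0-U»** (LEAD F0P3a-plan (g8) T7-58 (A) 2026-09-01;
A-p03 (g23)) over ★ g0 `CompactCoreCentralizerNonarch` (p838894: for `γ ∈ GL_N(E_w)` regular semisimple, `compactCore Z(γ)` is compact open and carries an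
inversion-invariant Haar measure of mass one).  The letters' carriers are not `GL_N(E_w)` but the local unitary groups `U(J)(F_v) = «local» E c N J v`
(★ `UnitaryGroupAutomorphicRep`) — ISOMORPHIC to `GL_N(E_w)` at a split place (★ `localSplitEquiv`), a CLOSED SUBGROUP `U(σ_w, J_w)(E_w)` of it at a
non-split place (★ `localNonsplitEquiv`) — and, on the endoscopic side, the PRODUCT `H_v = U(Φ₂)(F_v) × U(Φ₁)(F_v)`.  This file moves the three facts
(compact, open, normalised Haar exists) to those carriers:

* §1 GENERIC: (s1a) a centraliser mapping injectively into a commutative centraliser is commutative; (s1b) **`isCompact_compactCore_centralizer_of_isClosedEmbedding`**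
  — along a continuous closed-embedding homomorphism `φ : G →* G′`, compactness of `compactCore Z_{G′}(φ γ)` and closedness of `compactCore Z_G(γ)` give
  compactness of the latter (compact subgroups map to compact subgroups; `φ ∘ Subtype.val` is a closed embedding); (s2) PRODUCTS (over ★ `compactCore_prod` of ★ `OrbitalMeasureCanonicalExists`, F0P3a-p08): the centraliser of `(a, b)` is the product of the centralisers as a `≃ₜ*`, hence compactness ∕ openness ∕
  commutativity of the product core from the factors.
* §2 THE ENGINE at `E_w`: for a topological group `G` with ONE compact open subgroup `K` and a continuous closed-embedding homomorphism
  `φ : G →* GL_N(E_w)` with `φ γ` regular semisimple: **`isCompact_compactCore_centralizer_of_isClosedEmbedding_gl`**, `isOpen_…`, and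
  **`exists_isHaarMeasure_compactCore_centralizer_eq_one_of_isClosedEmbedding_gl`** (★ g0 + ★ `isOpen_compactCore_of_subgroup` ∕
  `exists_isHaarMeasure_compactCore_eq_one`).
* §3 `U(J)(F_v)`: at a SPLIT place (`φ = localSplitEquiv`, `K = localIntegralLevel`) and at a NON-SPLIT place (`φ = subtype ∘ localNonsplitEquiv`, closed by ★
  `isClosed_unitaryGroupOfForm`) the three facts for every `γ ∈ U(J)(F_v)` whose image in `GL_N(E_w)` has separable characteristic polynomial; the CM carriers
  `(cmDatum L N H).Local v` are these types definitionally (★ `cmDatum_Local`).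
* THE `H`-SIDE (LEAD (α′)(α″)): `H_v = (cmDatum L 2 Φ₂).Local v × (cmDatum L 1 Φ₁).Local v` is a product of two such groups (the `cmDatum` carriers ARE
  the `«local»` types, ★ `cmDatum_Local`), so for `γ_H = (γ₂, γ₁)` the three facts follow from the factors by §1 (s2):
  `isCompact_compactCore_centralizer_prod`, `isOpen_compactCore_centralizer_prod`, **`exists_isHaarMeasure_compactCore_centralizer_prod_eq_one`** (factor
  hypotheses = the §3 conclusions at the place type of `v`) — the per-class input of ★ `OrbitalMeasureFamily.IsCanonical` for the endoscopic families `mH`.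
HONEST LABEL: book-keeping over ★ g0; HC_CM is proved only modulo the printed citations until rung 0 closes; no count moves.

## Mathlib ∕ tree search
Tree: ★ `OrbitalMeasureCanonicalExists` (`compactCore_prod`; its `exists_isCanonical (P) (ν) (ht)` is the CONSUMER of this file's `∃ t` heads), ★ `CompactCoreCentralizerNonarch` (`isCompact_compactCore_centralizer`, `mul_comm_of_mem_centralizer_of_charpoly_separable`, §1 generic
`isOpen_compactCore_of_subgroup`, `isClosed_compactCore_of_subgroup`, `exists_subgroup_coe_eq_compactCore`, `exists_isHaarMeasure_compactCore_eq_one`,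
`inv_mem_compactCore`), ★ `OrbitalMeasureCanonical` (`image_compactCore`, `mem_compactCore_iff`, `subset_compactCore_of_isCompact`), ★ `UnitaryGroupSplitPlace`
(`localSplitEquiv`), ★ `LocalUnitaryGroupCongr` (`localNonsplitEquiv`), ★ `LocalUnitaryIntegralLevel` (`isCompact_localIntegralLevel`, `isOpen_localIntegralLevel`), ★
`LocalUnitaryGroupCongrMeasure` (`locallyCompactSpace_local`), ★ `UnitaryGroupOfFormAdelicTopology` (`isClosed_unitaryGroupOfForm`), ★ `GaloisActionPlaces`
(`continuous_galAdicCompletionMap`).  Mathlib: `Topology.IsClosedEmbedding.isCompact_preimage`, `Homeomorph.isClosedEmbedding`, `Subgroup.prod`,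
`Set.isClosed_centralizer`.  Dedup: `compactCore_prod` is ★ `OrbitalMeasureCanonicalExists` (F0P3a-p08 (g12), same night) — imported, not restated; `rg "centralizer_of_isClosedEmbedding|compactCore_centralizer_prod" Literature/` — no hits.

## References
* [Tits1979] J. Tits, *Reductive groups over local fields*, Proc. Sympos. Pure Math. 33.1 (1979), §3.9.
* [PlatonovRapinchuk1994] V. Platonov, A. Rapinchuk, *Algebraic Groups and Number Theory* (1994), §3.3, §5.1.
* [Rogawski1990] J. D. Rogawski, *Automorphic Representations of Unitary Groups in Three Variables* (1990), §4.3 p. 43.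
* [BourbakiGT1] N. Bourbaki, *General Topology*, Ch. III §2 (compact subgroups, products).
-/

set_option autoImplicit false

noncomputable section

open MeasureTheory Measure Set Filter Topology NumberField IsDedekindDomain
open scoped Pointwise ENNReal Matrix MatrixGroups

namespace Literature.NumberTheory.Automorphic

/-! ## §1 Generic: closed embeddings and products -/

section ClosedEmbedding

variable {G G' : Type*} [Group G] [Group G'] (φ : G →* G') (γ : G)

/-- The image of the centraliser of `γ` centralises `φ γ`. [cite: BourbakiGT1, Ch. III §2] -/
theorem apply_mem_centralizer_of_mem_centralizer {z : G} (hz : z ∈ Subgroup.centralizer ({γ} : Set G)) :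
    φ z ∈ Subgroup.centralizer ({φ γ} : Set G') := by
  rw [Subgroup.mem_centralizer_singleton_iff] at hz ⊢
  rw [← map_mul, ← map_mul, hz]

/-- **(s1a) A centraliser mapping injectively into a commutative centraliser is commutative.** [cite: Tits1979, §3.9] -/
theorem mul_comm_centralizer_of_injective (hφ : Function.Injective φ)
    (hcomm : ∀ a b : Subgroup.centralizer ({φ γ} : Set G'), a * b = b * a)
    (a b : Subgroup.centralizer ({γ} : Set G)) : a * b = b * a := by
  apply Subtype.ext
  apply hφ
  have h := congrArg (fun u : Subgroup.centralizer ({φ γ} : Set G') => (u : G'))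
    (hcomm ⟨φ a, apply_mem_centralizer_of_mem_centralizer φ γ a.2⟩ ⟨φ b, apply_mem_centralizer_of_mem_centralizer φ γ b.2⟩)
  simpa only [Subgroup.coe_mul, map_mul] using h

variable [TopologicalSpace G] [TopologicalSpace G'] [IsTopologicalGroup G] [T2Space G']

/-- **(s1b) Compactness of the compact core of a centraliser descends along a continuous closed-embedding homomorphism**: if
`compactCore Z_{G′}(φ γ)` is compact and `compactCore Z_G(γ)` is closed, the latter is compact (compact subgroups of `Z_G(γ)` map to compact subgroups
of `Z_{G′}(φ γ)`, and `φ ∘ Subtype.val` is a closed embedding). [cite: Tits1979, §3.9] [cite: PlatonovRapinchuk1994, §3.3] -/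
theorem isCompact_compactCore_centralizer_of_isClosedEmbedding (hφ : IsClosedEmbedding φ)
    (hZ' : IsCompact (compactCore (Subgroup.centralizer ({φ γ} : Set G'))))
    (hcl : IsClosed (compactCore (Subgroup.centralizer ({γ} : Set G)))) :
    IsCompact (compactCore (Subgroup.centralizer ({γ} : Set G))) := by
  haveI : T2Space G := hφ.isEmbedding.t2Space
  -- the closed embedding `φ ∘ val : Z_G(γ) → G'`
  have hval : IsClosedEmbedding ((φ : G → G') ∘ (Subtype.val : Subgroup.centralizer ({γ} : Set G) → G)) :=
    hφ.comp (Set.isClosed_centralizer _).isClosedEmbedding_subtypeVal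
  -- the compact set `val '' compactCore Z_{G'}(φ γ)` and its preimage
  have hC : IsCompact ((Subtype.val : Subgroup.centralizer ({φ γ} : Set G') → G') '' compactCore (Subgroup.centralizer ({φ γ} : Set G'))) :=
    hZ'.image continuous_subtype_val
  refine (hval.isCompact_preimage hC).of_isClosed_subset hcl fun z hz => ?_
  obtain ⟨K, hK, hzK⟩ := (mem_compactCore_iff z).1 hz
  -- the codomain-restricted homomorphism and the image subgroup
  let ψ : Subgroup.centralizer ({γ} : Set G) →* Subgroup.centralizer ({φ γ} : Set G') :=
    (φ.comp (Subgroup.centralizer ({γ} : Set G)).subtype).codRestrict _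
      fun u => apply_mem_centralizer_of_mem_centralizer φ γ u.2
  have hψc : Continuous ψ := (hφ.continuous.comp continuous_subtype_val).subtype_mk _
  refine ⟨ψ z, (mem_compactCore_iff _).2 ⟨K.map ψ, ?_, ⟨z, hzK, rfl⟩⟩, rfl⟩
  rw [Subgroup.coe_map]
  exact hK.image hψc

end ClosedEmbedding

section Products

variable {A B : Type*} [Group A] [Group B]

/-- The centraliser of `(a, b)` is the product of the centralisers. [cite: BourbakiGT1, Ch. III §2] -/
theorem centralizer_prod_singleton (a : A) (b : B) :
    Subgroup.centralizer ({(a, b)} : Set (A × B)) = (Subgroup.centralizer ({a} : Set A)).prod (Subgroup.centralizer ({b} : Set B)) := by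
  ext ⟨x, y⟩
  simp only [Subgroup.mem_centralizer_singleton_iff, Subgroup.mem_prod, Prod.mk_mul_mk, Prod.mk.injEq]

variable [TopologicalSpace A] [TopologicalSpace B] [IsTopologicalGroup A] [IsTopologicalGroup B]

/-- **(s2) The compact core of the centraliser of `(a, b)` is compact if those of `a` and `b` are.** [cite: BourbakiGT1, Ch. III §2] [cite: Tits1979, §3.9] -/
theorem isCompact_compactCore_centralizer_prod (a : A) (b : B)
    (ha : IsCompact (compactCore (Subgroup.centralizer ({a} : Set A)))) (hb : IsCompact (compactCore (Subgroup.centralizer ({b} : Set B)))) :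
    IsCompact (compactCore (Subgroup.centralizer ({(a, b)} : Set (A × B)))) := by
  -- the product centraliser as a topological group isomorphic to the product of the centralisers
  let e : Subgroup.centralizer ({(a, b)} : Set (A × B)) ≃ₜ*
      Subgroup.centralizer ({a} : Set A) × Subgroup.centralizer ({b} : Set B) :=
    { toFun := fun z => (⟨z.1.1, ((centralizer_prod_singleton a b).le z.2).1⟩, ⟨z.1.2, ((centralizer_prod_singleton a b).le z.2).2⟩)
      invFun := fun p => ⟨(p.1.1, p.2.1), (centralizer_prod_singleton a b).ge ⟨p.1.2, p.2.2⟩⟩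
      left_inv := fun z => rfl
      right_inv := fun p => rfl
      map_mul' := fun z z' => rfl
      continuous_toFun := by
        refine Continuous.prodMk ?_ ?_
        · exact (continuous_fst.comp continuous_subtype_val).subtype_mk _
        · exact (continuous_snd.comp continuous_subtype_val).subtype_mk _
      continuous_invFun := by
        exact ((continuous_subtype_val.comp continuous_fst).prodMk (continuous_subtype_val.comp continuous_snd)).subtype_mk _ }
  have himage : compactCore (Subgroup.centralizer ({(a, b)} : Set (A × B))) =
      e ⁻¹' compactCore (Subgroup.centralizer ({a} : Set A) × Subgroup.centralizer ({b} : Set B)) := by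
    rw [← image_compactCore e, e.injective.preimage_image]
  rw [himage, compactCore_prod]
  exact e.toHomeomorph.isClosedEmbedding.isCompact_preimage (ha.prod hb)

/-- **(s2) … open if those of `a` and `b` are.** [cite: BourbakiGT1, Ch. III §2] [cite: Tits1979, §3.9] -/
theorem isOpen_compactCore_centralizer_prod (a : A) (b : B)
    (ha : IsOpen (compactCore (Subgroup.centralizer ({a} : Set A)))) (hb : IsOpen (compactCore (Subgroup.centralizer ({b} : Set B)))) :
    IsOpen (compactCore (Subgroup.centralizer ({(a, b)} : Set (A × B)))) := by
  let e : Subgroup.centralizer ({(a, b)} : Set (A × B)) ≃ₜ*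
      Subgroup.centralizer ({a} : Set A) × Subgroup.centralizer ({b} : Set B) :=
    { toFun := fun z => (⟨z.1.1, ((centralizer_prod_singleton a b).le z.2).1⟩, ⟨z.1.2, ((centralizer_prod_singleton a b).le z.2).2⟩)
      invFun := fun p => ⟨(p.1.1, p.2.1), (centralizer_prod_singleton a b).ge ⟨p.1.2, p.2.2⟩⟩
      left_inv := fun z => rfl
      right_inv := fun p => rfl
      map_mul' := fun z z' => rfl
      continuous_toFun := by
        refine Continuous.prodMk ?_ ?_
        · exact (continuous_fst.comp continuous_subtype_val).subtype_mk _
        · exact (continuous_snd.comp continuous_subtype_val).subtype_mk _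
      continuous_invFun := by
        exact ((continuous_subtype_val.comp continuous_fst).prodMk (continuous_subtype_val.comp continuous_snd)).subtype_mk _ }
  have himage : compactCore (Subgroup.centralizer ({(a, b)} : Set (A × B))) =
      e ⁻¹' compactCore (Subgroup.centralizer ({a} : Set A) × Subgroup.centralizer ({b} : Set B)) := by
    rw [← image_compactCore e, e.injective.preimage_image]
  rw [himage, compactCore_prod]
  exact (ha.prod hb).preimage e.continuous

omit [TopologicalSpace A] [TopologicalSpace B] [IsTopologicalGroup A] [IsTopologicalGroup B] in
/-- Commutativity of the product centraliser from the factors. [cite: BourbakiGT1, Ch. III §2] -/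
theorem mul_comm_centralizer_prod (a : A) (b : B)
    (ha : ∀ x y : Subgroup.centralizer ({a} : Set A), x * y = y * x) (hb : ∀ x y : Subgroup.centralizer ({b} : Set B), x * y = y * x)
    (z z' : Subgroup.centralizer ({(a, b)} : Set (A × B))) : z * z' = z' * z := by
  apply Subtype.ext
  have h1 := congrArg (fun u : Subgroup.centralizer ({a} : Set A) => (u : A))
    (ha ⟨z.1.1, ((centralizer_prod_singleton a b).le z.2).1⟩ ⟨z'.1.1, ((centralizer_prod_singleton a b).le z'.2).1⟩)
  have h2 := congrArg (fun u : Subgroup.centralizer ({b} : Set B) => (u : B))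
    (hb ⟨z.1.2, ((centralizer_prod_singleton a b).le z.2).2⟩ ⟨z'.1.2, ((centralizer_prod_singleton a b).le z'.2).2⟩)
  simp only [Subgroup.coe_mul] at h1 h2
  exact Prod.ext h1 h2

/-- **(s2) The normalised Haar measure on the product centraliser** (compact open compact cores of the factors, commutative factors, locally compact).
[cite: Rogawski1990, §4.3 p. 43] [cite: Tits1979, §3.9] -/
theorem exists_isHaarMeasure_compactCore_centralizer_prod_eq_one [LocallyCompactSpace A] [LocallyCompactSpace B] [T2Space A] [T2Space B]
    (a : A) (b : B)
    (ha : ∀ x y : Subgroup.centralizer ({a} : Set A), x * y = y * x) (hb : ∀ x y : Subgroup.centralizer ({b} : Set B), x * y = y * x)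
    (hac : IsCompact (compactCore (Subgroup.centralizer ({a} : Set A)))) (hao : IsOpen (compactCore (Subgroup.centralizer ({a} : Set A))))
    (hbc : IsCompact (compactCore (Subgroup.centralizer ({b} : Set B)))) (hbo : IsOpen (compactCore (Subgroup.centralizer ({b} : Set B))))
    [MeasurableSpace (Subgroup.centralizer ({(a, b)} : Set (A × B)))] [BorelSpace (Subgroup.centralizer ({(a, b)} : Set (A × B)))] :
    ∃ t : Measure (Subgroup.centralizer ({(a, b)} : Set (A × B))),
      t.IsHaarMeasure ∧ t.IsInvInvariant ∧ t (compactCore (Subgroup.centralizer ({(a, b)} : Set (A × B)))) = 1 := by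
  haveI : LocallyCompactSpace (Subgroup.centralizer ({(a, b)} : Set (A × B))) :=
    (Set.isClosed_centralizer _).isClosedEmbedding_subtypeVal.locallyCompactSpace
  exact exists_isHaarMeasure_compactCore_eq_one (mul_comm_centralizer_prod a b ha hb)
    (isCompact_compactCore_centralizer_prod a b hac hbc) (isOpen_compactCore_centralizer_prod a b hao hbo)

end Products

/-! ## §2 The engine: a group with a compact open subgroup, closed-embedded into `GL_N(E_w)` -/

section Engine

variable {E : Type} [Field E] [NumberField E] (w : HeightOneSpectrum (𝓞 E)) {N : ℕ}
  {G : Type*} [Group G] [TopologicalSpace G] [IsTopologicalGroup G]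
  (K : Subgroup G) (hKc : IsCompact (K : Set G)) (hKo : IsOpen (K : Set G))
  (φ : G →* GL (Fin N) (w.adicCompletion E)) (hφ : IsClosedEmbedding φ) (γ : G)
  (hγ : (((φ γ : GL (Fin N) (w.adicCompletion E)) : Matrix (Fin N) (Fin N) (w.adicCompletion E)).charpoly).Separable)

omit [IsTopologicalGroup G] in
include hφ hγ in
/-- `Z_G(γ)` is commutative (★ `mul_comm_of_mem_centralizer_of_charpoly_separable` pulled back along the injective `φ`). [cite: Tits1979, §3.9] -/
theorem mul_comm_centralizer_of_isClosedEmbedding_gl (a b : Subgroup.centralizer ({γ} : Set G)) : a * b = b * a :=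
  mul_comm_centralizer_of_injective φ γ hφ.injective (mul_comm_of_mem_centralizer_of_charpoly_separable w (φ γ) hγ) a b

include hKc hKo hφ hγ in
/-- **`compactCore Z_G(γ)` is OPEN** (one compact open subgroup `K ∩ Z_G(γ)` of the commutative `Z_G(γ)`). [cite: Tits1979, §3.9] [cite: PlatonovRapinchuk1994, §3.3] -/
theorem isOpen_compactCore_centralizer_of_isClosedEmbedding_gl : IsOpen (compactCore (Subgroup.centralizer ({γ} : Set G))) := by
  haveI : T2Space G := hφ.isEmbedding.t2Space
  exact isOpen_compactCore_of_subgroup (mul_comm_centralizer_of_isClosedEmbedding_gl w φ hφ γ hγ) (K.subgroupOf _)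
    (by rw [Subgroup.coe_subgroupOf]; exact (Set.isClosed_centralizer _).isClosedEmbedding_subtypeVal.isCompact_preimage hKc)
    (by rw [Subgroup.coe_subgroupOf]; exact hKo.preimage continuous_subtype_val)

include hKc hKo hφ hγ in
/-- **… CLOSED.** [cite: Tits1979, §3.9] -/
theorem isClosed_compactCore_centralizer_of_isClosedEmbedding_gl : IsClosed (compactCore (Subgroup.centralizer ({γ} : Set G))) := by
  haveI : T2Space G := hφ.isEmbedding.t2Space
  exact isClosed_compactCore_of_subgroup (mul_comm_centralizer_of_isClosedEmbedding_gl w φ hφ γ hγ) (K.subgroupOf _)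
    (by rw [Subgroup.coe_subgroupOf]; exact (Set.isClosed_centralizer _).isClosedEmbedding_subtypeVal.isCompact_preimage hKc)
    (by rw [Subgroup.coe_subgroupOf]; exact hKo.preimage continuous_subtype_val)

include hKc hKo hφ hγ in
/-- **… and COMPACT** (★ g0 `isCompact_compactCore_centralizer` in `GL_N(E_w)` descended along `φ`, §1 (s1b)). [cite: Tits1979, §3.9] [cite: PlatonovRapinchuk1994, §3.3] -/
theorem isCompact_compactCore_centralizer_of_isClosedEmbedding_gl : IsCompact (compactCore (Subgroup.centralizer ({γ} : Set G))) :=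
  isCompact_compactCore_centralizer_of_isClosedEmbedding φ γ hφ (isCompact_compactCore_centralizer w (φ γ) hγ)
    (isClosed_compactCore_centralizer_of_isClosedEmbedding_gl w K hKc hKo φ hφ γ hγ)

include hKc hKo hφ hγ in
/-- **THE NORMALISED TORUS MEASURE on `Z_G(γ)`**: a Haar measure, inversion-invariant, with `t (compactCore Z_G(γ)) = 1` — the `∃ t` conjunct of ★
`OrbitalMeasureFamily.IsCanonical` for the class of `γ`. [cite: Rogawski1990, §4.3 p. 43] [cite: Tits1979, §3.9] -/
theorem exists_isHaarMeasure_compactCore_centralizer_eq_one_of_isClosedEmbedding_gl [LocallyCompactSpace G]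
    [MeasurableSpace (Subgroup.centralizer ({γ} : Set G))] [BorelSpace (Subgroup.centralizer ({γ} : Set G))] :
    ∃ t : Measure (Subgroup.centralizer ({γ} : Set G)),
      t.IsHaarMeasure ∧ t.IsInvInvariant ∧ t (compactCore (Subgroup.centralizer ({γ} : Set G))) = 1 := by
  haveI : T2Space G := hφ.isEmbedding.t2Space
  haveI : LocallyCompactSpace (Subgroup.centralizer ({γ} : Set G)) :=
    (Set.isClosed_centralizer _).isClosedEmbedding_subtypeVal.locallyCompactSpace
  exact exists_isHaarMeasure_compactCore_eq_one (mul_comm_centralizer_of_isClosedEmbedding_gl w φ hφ γ hγ)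
    (isCompact_compactCore_centralizer_of_isClosedEmbedding_gl w K hKc hKo φ hφ γ hγ)
    (isOpen_compactCore_centralizer_of_isClosedEmbedding_gl w K hKc hKo φ hφ γ hγ)

end Engine

/-! ## §3 `U(J)(F_v)` at a split and at a non-split place -/

namespace UnitaryGroup

variable {F E : Type} [Field F] [NumberField F] [Field E] [NumberField E] [Algebra F E]
  [Algebra.IsQuadraticExtension F E]
  (c : E ≃ₐ[F] E) (N : ℕ) (J : Matrix (Fin N) (Fin N) E) {v : HeightOneSpectrum (𝓞 F)} (hc : c ≠ 1)

section Split

variable (hJ : (J.map c)ᵀ = J) (w : PlacesOver E v) (hw : c • w.1 ≠ w.1) (hJw : IsUnit (placeForm J w.1))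
  (γ : «local» E c N J v)
  (hγ : (((localSplitEquiv c J hc hJ w hw hJw γ : GL (Fin N) (w.1.adicCompletion E)) :
    Matrix (Fin N) (Fin N) (w.1.adicCompletion E)).charpoly).Separable)

include hγ in
/-- **Split place: `compactCore Z_{U(J)(F_v)}(γ)` is COMPACT** for `γ` with regular semisimple image under `e = localSplitEquiv` (§2 at `φ = e`,
`K = U(J)(𝒪_v)` ★ `localIntegralLevel`). [cite: Tits1979, §3.9] [cite: PlatonovRapinchuk1994, §5.1] -/
theorem isCompact_compactCore_centralizer_local_of_split :
    IsCompact (compactCore (Subgroup.centralizer ({γ} : Set («local» E c N J v)))) :=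
  isCompact_compactCore_centralizer_of_isClosedEmbedding_gl w.1 (localIntegralLevel c N J v) (isCompact_localIntegralLevel c N J v)
    (isOpen_localIntegralLevel c N J v) (localSplitEquiv c J hc hJ w hw hJw).toMonoidHom
    (localSplitEquiv c J hc hJ w hw hJw).toHomeomorph.isClosedEmbedding γ hγ

include hγ in
/-- **Split place: … OPEN.** [cite: Tits1979, §3.9] [cite: PlatonovRapinchuk1994, §5.1] -/
theorem isOpen_compactCore_centralizer_local_of_split :
    IsOpen (compactCore (Subgroup.centralizer ({γ} : Set («local» E c N J v)))) :=
  isOpen_compactCore_centralizer_of_isClosedEmbedding_gl w.1 (localIntegralLevel c N J v) (isCompact_localIntegralLevel c N J v)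
    (isOpen_localIntegralLevel c N J v) (localSplitEquiv c J hc hJ w hw hJw).toMonoidHom
    (localSplitEquiv c J hc hJ w hw hJw).toHomeomorph.isClosedEmbedding γ hγ

include hγ in
/-- **Split place: the normalised torus measure exists** (`∃ t` Haar, inversion-invariant, `t (compactCore) = 1`). [cite: Rogawski1990, §4.3 p. 43] -/
theorem exists_isHaarMeasure_compactCore_centralizer_local_eq_one_of_split
    [MeasurableSpace (Subgroup.centralizer ({γ} : Set («local» E c N J v)))] [BorelSpace (Subgroup.centralizer ({γ} : Set («local» E c N J v)))] :
    ∃ t : Measure (Subgroup.centralizer ({γ} : Set («local» E c N J v))),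
      t.IsHaarMeasure ∧ t.IsInvInvariant ∧ t (compactCore (Subgroup.centralizer ({γ} : Set («local» E c N J v)))) = 1 :=
  exists_isHaarMeasure_compactCore_centralizer_eq_one_of_isClosedEmbedding_gl w.1 (localIntegralLevel c N J v)
    (isCompact_localIntegralLevel c N J v) (isOpen_localIntegralLevel c N J v) (localSplitEquiv c J hc hJ w hw hJw).toMonoidHom
    (localSplitEquiv c J hc hJ w hw hJw).toHomeomorph.isClosedEmbedding γ hγ

end Split

section Nonsplit

variable (w : PlacesOver E v) (hw : c • w.1 = w.1) (γ : «local» E c N J v)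
  (hγ : ((((localNonsplitEquiv c J hc w hw γ :
      unitaryGroupOfForm (galAdicCompletionMap (L := E) c hw) (placeForm J w.1)) : GL (Fin N) (w.1.adicCompletion E)) :
    Matrix (Fin N) (Fin N) (w.1.adicCompletion E)).charpoly).Separable)

/-- The non-split one-place model followed by the inclusion `U(σ_w, J_w)(E_w) ≤ GL_N(E_w)` is a continuous closed-embedding homomorphism
(★ `localNonsplitEquiv` is a homeomorphism; ★ `isClosed_unitaryGroupOfForm`). [cite: PlatonovRapinchuk1994, §5.1] -/
theorem isClosedEmbedding_subtype_comp_localNonsplitEquiv :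
    IsClosedEmbedding ((unitaryGroupOfForm (galAdicCompletionMap (L := E) c hw) (placeForm J w.1)).subtype.comp
      (localNonsplitEquiv c J hc w hw).toMonoidHom) :=
  (isClosed_unitaryGroupOfForm (continuous_galAdicCompletionMap E c hw) (placeForm J w.1)).isClosedEmbedding_subtypeVal.comp
    (localNonsplitEquiv c J hc w hw).toHomeomorph.isClosedEmbedding

include hγ in
/-- **Non-split place: `compactCore Z_{U(J)(F_v)}(γ)` is COMPACT** for `γ` with regular semisimple image in `GL_N(E_w)` (§2 at
`φ = subtype ∘ localNonsplitEquiv`, `K = U(J)(𝒪_v)`). [cite: Tits1979, §3.9] [cite: PlatonovRapinchuk1994, §5.1] -/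
theorem isCompact_compactCore_centralizer_local_of_nonsplit :
    IsCompact (compactCore (Subgroup.centralizer ({γ} : Set («local» E c N J v)))) :=
  isCompact_compactCore_centralizer_of_isClosedEmbedding_gl w.1 (localIntegralLevel c N J v) (isCompact_localIntegralLevel c N J v)
    (isOpen_localIntegralLevel c N J v) _ (isClosedEmbedding_subtype_comp_localNonsplitEquiv c N J hc w hw) γ hγ

include hγ in
/-- **Non-split place: … OPEN.** [cite: Tits1979, §3.9] [cite: PlatonovRapinchuk1994, §5.1] -/
theorem isOpen_compactCore_centralizer_local_of_nonsplit :
    IsOpen (compactCore (Subgroup.centralizer ({γ} : Set («local» E c N J v)))) :=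
  isOpen_compactCore_centralizer_of_isClosedEmbedding_gl w.1 (localIntegralLevel c N J v) (isCompact_localIntegralLevel c N J v)
    (isOpen_localIntegralLevel c N J v) _ (isClosedEmbedding_subtype_comp_localNonsplitEquiv c N J hc w hw) γ hγ

include hγ in
/-- **Non-split place: the normalised torus measure exists.** [cite: Rogawski1990, §4.3 p. 43] -/
theorem exists_isHaarMeasure_compactCore_centralizer_local_eq_one_of_nonsplit
    [MeasurableSpace (Subgroup.centralizer ({γ} : Set («local» E c N J v)))] [BorelSpace (Subgroup.centralizer ({γ} : Set («local» E c N J v)))] :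
    ∃ t : Measure (Subgroup.centralizer ({γ} : Set («local» E c N J v))),
      t.IsHaarMeasure ∧ t.IsInvInvariant ∧ t (compactCore (Subgroup.centralizer ({γ} : Set («local» E c N J v)))) = 1 :=
  exists_isHaarMeasure_compactCore_centralizer_eq_one_of_isClosedEmbedding_gl w.1 (localIntegralLevel c N J v)
    (isCompact_localIntegralLevel c N J v) (isOpen_localIntegralLevel c N J v) _
    (isClosedEmbedding_subtype_comp_localNonsplitEquiv c N J hc w hw) γ hγ

end Nonsplit

end UnitaryGroup

end Literature.NumberTheory.Automorphic

end
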